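import Literature.NumberTheory.NumberFields.StickelbergerTheorem
import Literature.NumberTheory.DiophantineGeometry.CatalanCasselsTheorem
import HarnessLib

/-!
# `(x - ζ_p)^θ` is a `q`-th power for `θ ∈ (1 - ι)𝒮` [Schoof2009, Proposition 10.1]

Let `p, q` be distinct odd primes, `x, y` non-zero integers with `x ^ p - y ^ q = 1`, `K = ℚ(ζ_p)`,
`G = Gal(K/ℚ) = {σ_c : c ∈ (ℤ/pℤ)ˣ}` (`σ_c ζ_p = ζ_p^c`), `ι = σ_{-1}` and `𝒮 ⊆ ℤ[G]` the
Stickelberger ideal. [Schoof2009, Proposition 10.1]: *for every `θ` in the ideal `I = (1 - ι)𝒮`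
the element `(x - ζ_p)^θ = ∏_σ σ(x - ζ_p)^{n_σ}` (`θ = ∑ n_σ σ`) is a `q`-th power in `K^*`.* This is
the input of the "minus argument" [Schoof2009, Chapter 11] (Mihăilescu's Theorem III), which needs
it for all `θ ∈ I`, not only for the one element `ι θ₂` that suffices for Theorem I.

We prove it in the following explicit form. For `θ ∈ ℤ[G]` (`MonoidAlgebra ℤ (ZMod p)ˣ`, the
coefficient of `σ_c` being `θ.coeff c`, as in `StickelbergerIdeal`) put
`Catalan.Minus.zpowGal hζ x θ = ∏_c (x - ζ^c)^{θ.coeff c} ∈ K` (`= (x - ζ_p)^θ`). Then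

* `Catalan.Minus.zpowGal_add/neg/sub/zsmul/single_mul` — `θ ↦ (x - ζ_p)^θ` is a `G`-equivariant
  homomorphism `(ℤ[G], +) → K^*`;
* `Catalan.Minus.exists_zpowGal_theta_eq_pow` — **for every `b`, `(x - ζ_p)^{(1-ι)θ_b} = α^q` for
  some `α ∈ K^*`** (`θ_b = ∑_c ⌊bc/p⌋ σ_c⁻¹` the generators of `𝒮`);
* `Catalan.Minus.exists_zpowGal_eq_pow` — the same for every `θ` in the `ℤ`-span of the
  `(1 - ι)θ_b` (which contains `(1 - ι)𝒮 ∋ e_i = (1-ι)(θ_{i+1} - θ_i)`).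

Proof, following [Schoof2009, p. 66]: `(x - ζ_p) = 𝔭 𝔟^q` with `𝔭 = (1 - ζ_p)` and `𝔟` supported on
primes of degree one ([Schoof2009, Propositions 7.2, 7.3], here `span_sub_zeta_eq` from Cassels'
Corollary 6.5); `𝔟^{θ_b}` is principal by Stickelberger's theorem
(`Stickelberger.isPrincipal_idealPow_quot_of_factors`, [Schoof2009, Theorem 9.5]); hence
`(x - ζ_p)^{θ_b} = ε π^s γ^q` with a unit `ε`, and applying `1 - ι` kills `π^s` up to the root of
unity `-ζ_p` and turns `ε` into `ε^{1-ι}`, a root of unity by Kronecker's theorem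
([Schoof2009, Lemma 7.1 (ii), Exercise 7.3]; Mathlib's `NumberField.Units.mem_torsion`), and the
roots of unity of `K`, of order `2p`, are `q`-th powers.

Everything is proved; the only definition is `zpowGal`.

## References

* R. Schoof, *Catalan's Conjecture*, Universitext, Springer 2009 [Schoof2009], Lemma 7.1,
  Propositions 7.2, 7.3, 10.1 (book pp. 41–43, 66) — held,
  `lit read book:schoof2009-catalan-s-conjecture` (PDF pp. 120–122, 147).
* P. Mihăilescu, *On the class groups of cyclotomic extensions in presence of a solution to
  Catalan's equation*, J. Number Theory **118** (2006), 123–144 (the minus argument).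
-/

namespace Literature.NumberTheory.DiophantineGeometry

namespace Catalan.Minus

open NumberField IsCyclotomicExtension Finset UniqueFactorizationMonoid Polynomial MonoidAlgebra
open Literature.NumberTheory.NumberFields.Stickelberger
open scoped Pointwise

section Cyclotomic

variable {p : ℕ} [hp : Fact p.Prime] {K : Type*} [Field K] [NumberField K]
  [hK : IsCyclotomicExtension {p} ℚ K] {ζ : K} (hζ : IsPrimitiveRoot ζ p)

omit [NumberField K] hK in
/-- `x^p - 1 = ∏_{i<p} (x - ζ^i)` in `𝓞 K`. [folklore] -/
theorem pow_sub_one_eq_prod (x : 𝓞 K) : x ^ p - 1 = ∏ i ∈ range p, (x - hζ.toInteger ^ i) := by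
  have h := X_pow_sub_C_eq_prod hζ.toInteger_isPrimitiveRoot hp.out.pos (one_pow p)
  have := congrArg (Polynomial.eval x) h
  simp only [eval_sub, eval_pow, eval_X, eval_C, eval_prod, mul_one] at this
  exact this

omit [NumberField K] hK in
/-- `∏_{1 ≤ i < p} (x - ζ^i) = ∑_{i<p} x^i` for `x ≠ 1`. [folklore] -/
theorem prod_Ico_sub_pow_eq_geom_sum {x : 𝓞 K} (hx : x ≠ 1) :
    ∏ i ∈ Ico 1 p, (x - hζ.toInteger ^ i) = ∑ i ∈ range p, x ^ i := by
  have h1 := pow_sub_one_eq_prod hζ x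
  rw [← Finset.prod_range_mul_prod_Ico _ hp.out.one_lt.le, prod_range_one, pow_zero] at h1
  have h2 : (∑ i ∈ range p, x ^ i) * (x - 1) = x ^ p - 1 := geom_sum_mul x p
  have hx1 : x - 1 ≠ 0 := sub_ne_zero.mpr hx
  apply mul_left_cancel₀ hx1
  rw [← h1, ← h2, mul_comm]

omit [NumberField K] hK in
/-- `(ζ - 1)^2 ∣ p` for `p ≥ 3`. [folklore] -/
theorem zeta_sub_one_sq_dvd_p (hp3 : 3 ≤ p) : (hζ.toInteger - 1) ^ 2 ∣ (p : 𝓞 K) := by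
  have h := (IsCyclotomicExtension.Rat.associated_zeta_sub_one_pow_prime p hζ).dvd
  exact (pow_dvd_pow _ (by omega : 2 ≤ p - 1)).trans h

omit [NumberField K] hK in
/-- `ζ^j - 1` is associated to `ζ - 1` for `p ∤ j`. [folklore] -/
theorem associated_pow_sub_one {j : ℕ} (hj : ¬ p ∣ j) :
    Associated (hζ.toInteger ^ j - 1) (hζ.toInteger - 1) :=
  (hζ.toInteger_isPrimitiveRoot.associated_sub_one_pow_sub_one_of_coprime
    ((Nat.coprime_comm).mp ((Nat.Prime.coprime_iff_not_dvd hp.out).mpr hj))).symm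

/-- the prime element `ζ - 1`. [folklore] -/
theorem prime_zeta_sub_one : Prime (hζ.toInteger - 1) := hζ.zeta_sub_one_prime'


/-- a rational prime in every non-zero prime ideal of `𝓞 K`. [folklore] -/
theorem exists_nat_prime_mem {P : Ideal (𝓞 K)} [hP : P.IsPrime] (hP0 : P ≠ ⊥) :
    ∃ l : ℕ, l.Prime ∧ (l : 𝓞 K) ∈ P := by
  have hN0 : Ideal.absNorm P ≠ 0 := Ideal.absNorm_eq_zero_iff.not.mpr hP0
  have hN1 : Ideal.absNorm P ≠ 1 := Ideal.absNorm_eq_one_iff.not.mpr hP.ne_top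
  have hmem : ((Ideal.absNorm P : ℕ) : 𝓞 K) ∈ P := Ideal.absNorm_mem P
  -- some prime factor of `N` lies in `P`
  have key : ∀ n : ℕ, 2 ≤ n → (n : 𝓞 K) ∈ P → ∃ l : ℕ, l.Prime ∧ (l : 𝓞 K) ∈ P := by
    intro n
    induction n using Nat.strong_induction_on with
    | _ n ih =>
      intro hn2 hn
      have hmin : n.minFac.Prime := Nat.minFac_prime (by omega)
      obtain ⟨m, hm⟩ := Nat.minFac_dvd n
      have hn' : ((n.minFac * m : ℕ) : 𝓞 K) ∈ P := by rw [← hm]; exact hn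
      rw [Nat.cast_mul] at hn'
      rcases hP.mem_or_mem hn' with h | h
      · exact ⟨_, hmin, h⟩
      · have h2 := hmin.two_le
        have hm1 : m ≠ 1 := by
          rintro rfl
          rw [Nat.cast_one] at h
          exact hP.ne_top ((Ideal.eq_top_iff_one P).mpr h)
        have hm0 : m ≠ 0 := by
          rintro rfl
          rw [mul_zero] at hm
          omega
        have hmn : m < n := by
          have : 2 * m ≤ n := by rw [hm]; exact Nat.mul_le_mul_right m h2
          omega
        exact ih m hmn (by omega) h
  exact key _ (by omega) hmem

omit [NumberField K] in
/-- if a rational prime `l` lies in the prime `P`, then `P ∩ ℤ = (l)`. [folklore] -/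
theorem intCast_mem_iff {P : Ideal (𝓞 K)} [hP : P.IsPrime] {l : ℕ} (hl : l.Prime)
    (hlP : (l : 𝓞 K) ∈ P) (n : ℤ) : (n : 𝓞 K) ∈ P ↔ (l : ℤ) ∣ n := by
  haveI := Fact.mk hl
  haveI := liesOver_of_mem (K := K) hlP
  have h : (n : 𝓞 K) ∈ P ↔ n ∈ P.under ℤ := by
    rw [Ideal.under_def, Ideal.mem_comap, eq_intCast]
  rw [h, ← Ideal.over_def P (Ideal.span {(l : ℤ)}), Ideal.mem_span_singleton]

/-- `p ∣ l - 1` if some integer has order `p` modulo the prime `l`. [folklore] -/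
theorem dvd_sub_one_of_pow_eq_one {l : ℕ} (hl : l.Prime) {x : ℤ} (h1 : (l : ℤ) ∣ x ^ p - 1)
    (h2 : ¬ (l : ℤ) ∣ x - 1) : p ∣ l - 1 := by
  haveI := Fact.mk hl
  have hx1 : ((x : ZMod l)) ^ p = 1 := by
    have := (ZMod.intCast_zmod_eq_zero_iff_dvd _ l).mpr h1
    push_cast at this
    exact sub_eq_zero.mp this
  have hx2 : (x : ZMod l) ≠ 1 := by
    intro h
    apply h2
    rw [← ZMod.intCast_zmod_eq_zero_iff_dvd]
    push_cast
    rw [h, sub_self]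
  have hx0 : (x : ZMod l) ≠ 0 := by
    intro h
    rw [h, zero_pow hp.out.ne_zero] at hx1
    exact zero_ne_one hx1
  have hord : orderOf (x : ZMod l) = p := orderOf_eq_prime hx1 hx2
  rw [← hord]
  exact orderOf_dvd_of_pow_eq_one (ZMod.pow_card_sub_one_eq_one hx0)

/-- **The ideal `(x - ζ_p)` of a Catalan solution** [Schoof2009, Proposition 7.2 and the proof of
Corollary 6.5]: if `∑_{i<p} x^i = p v^q` with `p ∣ x - 1`, `p ∤ v`, `x ≠ 1` (integers), then
`(x - ζ) = 𝔭 · 𝔟^q` with `𝔭 = (ζ - 1)` and `𝔟 ≠ 0` an ideal all of whose prime factors contain a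
rational prime `l ≡ 1 (mod p)` (they have degree one: `ζ ≡ x (mod 𝔯)`).
[cite: Schoof2009, Propositions 7.2, 7.3] -/
theorem span_sub_zeta_eq (hp3 : 3 ≤ p) {x v : ℤ} {q : ℕ} (hq : q ≠ 0) (hx1 : x ≠ 1)
    (hS : ∑ i ∈ range p, x ^ i = p * v ^ q) (hpx : (p : ℤ) ∣ x - 1) :
    ∃ 𝔟 : Ideal (𝓞 K),
      Ideal.span {(x : 𝓞 K) - hζ.toInteger} = Ideal.span {hζ.toInteger - 1} * 𝔟 ^ q ∧ 𝔟 ≠ ⊥ ∧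
      ∀ P ∈ normalizedFactors 𝔟, ∃ l : ℕ, l.Prime ∧ p ∣ l - 1 ∧ (l : 𝓞 K) ∈ P := by
  classical
  set π : 𝓞 K := hζ.toInteger - 1 with hπ
  have hπp : Prime π := prime_zeta_sub_one hζ
  set α : ℕ → 𝓞 K := fun i => (x : 𝓞 K) - hζ.toInteger ^ i with hα
  -- `π ∣ x - 1`, even `π² ∣ x - 1`
  have hπx : π ^ 2 ∣ (x : 𝓞 K) - 1 := by
    obtain ⟨w, hw⟩ := hpx
    have : ((x : 𝓞 K)) - 1 = (p : 𝓞 K) * w := by exact_mod_cast hw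
    rw [this]
    exact (zeta_sub_one_sq_dvd_p hζ hp3).mul_right _
  -- `α i = π β i`
  have hdiv : ∀ i, π ∣ α i := by
    intro i
    have e : α i = ((x : 𝓞 K) - 1) - (hζ.toInteger ^ i - 1) := by simp only [hα]; ring
    rw [e]
    exact dvd_sub ((dvd_pow_self π two_ne_zero).trans hπx) (sub_one_dvd_pow_sub_one _ _)
  choose β hβ using hdiv
  -- `π ∤ β i` for `1 ≤ i < p`
  have hπβ : ∀ i ∈ Ico 1 p, ¬ π ∣ β i := by
    intro i hi hdvd
    have hi' := Finset.mem_Ico.mp hi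
    have h2 : π ^ 2 ∣ α i := by rw [hβ i, sq]; exact mul_dvd_mul_left π hdvd
    have e : hζ.toInteger ^ i - 1 = ((x : 𝓞 K) - 1) - α i := by simp only [hα]; ring
    have h3 : π ^ 2 ∣ hζ.toInteger ^ i - 1 := by rw [e]; exact dvd_sub hπx h2
    obtain ⟨u, hu⟩ := associated_pow_sub_one hζ (j := i) (fun h => by
      have := Nat.le_of_dvd (by omega) h; omega)
    -- `ζ^i - 1 = π u⁻¹`... : `π² ∣ (ζ^i - 1)` and `(ζ^i - 1) ∣ π`, so `π² ∣ π`
    have h4 : π ^ 2 ∣ π := h3.trans ⟨u, hu.symm⟩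
    rw [sq] at h4
    exact hπp.not_unit ((isUnit_of_dvd_one (a := π)) ((mul_dvd_mul_iff_left hπp.ne_zero).mp
      (by simpa using h4)))
  -- the product of the `α i`
  have hxK : (x : 𝓞 K) ≠ 1 := by exact_mod_cast hx1
  have hprodα : ∏ i ∈ Ico 1 p, α i = (p : 𝓞 K) * (v : 𝓞 K) ^ q := by
    rw [hα, prod_Ico_sub_pow_eq_geom_sum hζ hxK]
    exact_mod_cast congrArg (Int.cast : ℤ → 𝓞 K) hS
  -- hence `∏ (β i) = (v)^q` as ideals
  have hprodβ : ∏ i ∈ Ico 1 p, Ideal.span {β i} = Ideal.span {(v : 𝓞 K)} ^ q := by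
    rw [Ideal.prod_span_singleton, Ideal.span_singleton_pow, Ideal.span_singleton_eq_span_singleton]
    -- `π^(p-1) ∏ β i = p v^q` and `p ~ π^(p-1)`
    have e1 : ∏ i ∈ Ico 1 p, α i = π ^ (p - 1) * ∏ i ∈ Ico 1 p, β i := by
      rw [← Nat.card_Ico 1 p, ← Finset.prod_const, ← Finset.prod_mul_distrib]
      exact Finset.prod_congr rfl fun i _ => hβ i
    obtain ⟨ε₀, hε₀⟩ := IsCyclotomicExtension.Rat.associated_zeta_sub_one_pow_prime p hζ
    rw [hprodα, ← hε₀, mul_assoc] at e1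
    have hπ0 : π ^ (p - 1) ≠ 0 := pow_ne_zero _ hπp.ne_zero
    have e2 := mul_left_cancel₀ hπ0 e1
    exact ⟨ε₀⁻¹, by rw [← e2, mul_comm (ε₀ : 𝓞 K), mul_assoc, Units.mul_inv, mul_one]⟩
  -- pairwise coprime
  have hmax : (Ideal.span {π}).IsMaximal :=
    ((Ideal.span_singleton_prime hπp.ne_zero).mpr hπp).isMaximal
      ((Ideal.span_singleton_eq_bot.not).mpr hπp.ne_zero)
  have hcop : ∀ i ∈ Ico 1 p, ∀ j ∈ Ico 1 p, i ≠ j →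
      IsCoprime (Ideal.span {β i}) (Ideal.span {β j}) := by
    intro i hi j hj hij
    rw [Ideal.isCoprime_iff_sup_eq]
    by_contra hne
    obtain ⟨M, hM, hle⟩ := Ideal.exists_le_maximal _ hne
    have hiM : β i ∈ M := hle (Ideal.mem_sup_left (Ideal.mem_span_singleton_self _))
    have hjM : β j ∈ M := hle (Ideal.mem_sup_right (Ideal.mem_span_singleton_self _))
    have hi' := Finset.mem_Ico.mp hi
    have hj' := Finset.mem_Ico.mp hj
    -- `ζ^j - ζ^i ∈ M`, and it is associated to `π`
    have h1 : α i - α j ∈ M := by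
      rw [hβ i, hβ j, ← mul_sub]
      exact M.mul_mem_left _ (M.sub_mem hiM hjM)
    have e : α i - α j = hζ.toInteger ^ i * (hζ.toInteger ^ (j + (p - i)) - 1) := by
      simp only [hα]
      rw [mul_sub, ← pow_add, show i + (j + (p - i)) = j + p by omega, pow_add,
        hζ.toInteger_isPrimitiveRoot.pow_eq_one]
      ring
    rw [e] at h1
    have hunit : IsUnit (hζ.toInteger ^ i) := (hζ.toInteger_isPrimitiveRoot.isUnit hp.out.ne_zero).pow i
    have h2 : hζ.toInteger ^ (j + (p - i)) - 1 ∈ M :=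
      (hM.isPrime.mem_or_mem h1).resolve_left fun h => hM.ne_top (M.eq_top_of_isUnit_mem h hunit)
    obtain ⟨u, hu⟩ := associated_pow_sub_one hζ (j := j + (p - i)) (fun h => by
      apply hij
      have h' : (p : ℤ) ∣ (j : ℤ) - i := by
        have e2 : ((j + (p - i) : ℕ) : ℤ) = (p : ℤ) + ((j : ℤ) - i) := by
          push_cast [Nat.cast_sub (show i ≤ p by omega)]
          ring
        have h2 := Int.natCast_dvd_natCast.mpr h
        rw [e2] at h2
        exact (Int.dvd_add_right (dvd_refl (p : ℤ))).mp h2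
      have := Int.eq_zero_of_abs_lt_dvd h' (by
        rw [abs_lt]
        constructor <;> omega)
      omega)
    have hπM : π ∈ M := by
      rw [hπ, ← hu]
      exact M.mul_mem_right _ h2
    have hMeq : M = Ideal.span {π} :=
      (hmax.eq_of_le hM.ne_top ((Ideal.span_singleton_le_iff_mem _).mpr hπM)).symm
    rw [hMeq, Ideal.mem_span_singleton] at hiM
    exact hπβ i hi hiM
  -- `span {β 1} = 𝔟 ^ q`
  have h1p : (1 : ℕ) ∈ Ico 1 p := Finset.mem_Ico.mpr ⟨le_rfl, hp.out.one_lt⟩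
  have hsplit : Ideal.span {β 1} * ∏ i ∈ Ico 2 p, Ideal.span {β i} =
      Ideal.span {(v : 𝓞 K)} ^ q := by
    rw [← hprodβ, ← Finset.prod_Ico_consecutive _ (show 1 ≤ 2 by norm_num) hp.out.two_le,
      Nat.Ico_succ_singleton, Finset.prod_singleton]
  have hcop1 : IsCoprime (Ideal.span {β 1}) (∏ i ∈ Ico 2 p, Ideal.span {β i}) := by
    apply IsCoprime.prod_right
    intro i hi
    have hi' := Finset.mem_Ico.mp hi
    exact hcop 1 h1p i (Finset.mem_Ico.mpr ⟨by omega, hi'.2⟩) (by omega)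
  have hunit : IsUnit (gcd (Ideal.span {β 1}) (∏ i ∈ Ico 2 p, Ideal.span {β i})) := by
    rw [Ideal.gcd_eq_sup, Ideal.isUnit_iff, ← Ideal.isCoprime_iff_sup_eq]
    exact hcop1
  obtain ⟨𝔟, h𝔟⟩ := exists_eq_pow_of_mul_eq_pow hunit hsplit
  have hβ10 : β 1 ≠ 0 := fun h0 => hπβ 1 h1p (by rw [h0]; exact dvd_zero π)
  have h𝔟0 : 𝔟 ≠ ⊥ := by
    intro h0
    rw [h0, ← Ideal.zero_eq_bot, zero_pow hq, Ideal.zero_eq_bot, Ideal.span_singleton_eq_bot] at h𝔟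
    exact hβ10 h𝔟
  refine ⟨𝔟, ?_, h𝔟0, ?_⟩
  · rw [show (x : 𝓞 K) - hζ.toInteger = α 1 by simp [hα], hβ 1,
      ← Ideal.span_singleton_mul_span_singleton, h𝔟]
  · intro P hP
    have hPp : Prime P := prime_of_normalized_factor P hP
    haveI hPprime : P.IsPrime := Ideal.isPrime_of_prime hPp
    have h𝔟P : 𝔟 ≤ P := ((Ideal.mem_normalizedFactors_iff h𝔟0).mp hP).2
    have hβ1P : β 1 ∈ P := by
      have : Ideal.span {β 1} ≤ P := h𝔟 ▸ (Ideal.pow_le_self hq).trans h𝔟P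
      exact (Ideal.span_singleton_le_iff_mem _).mp this
    have hα1P : α 1 ∈ P := by rw [hβ 1]; exact P.mul_mem_left _ hβ1P
    have hπP : π ∉ P := fun h => hπβ 1 h1p (by
      have hPeq : P = Ideal.span {π} :=
        (hmax.eq_of_le hPprime.ne_top ((Ideal.span_singleton_le_iff_mem _).mpr h)).symm
      rw [hPeq, Ideal.mem_span_singleton] at hβ1P
      exact hβ1P)
    obtain ⟨l, hl, hlP⟩ := exists_nat_prime_mem hPp.ne_zero
    refine ⟨l, hl, ?_, hlP⟩
    apply dvd_sub_one_of_pow_eq_one hl (x := x)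
    · rw [← intCast_mem_iff hl hlP]
      push_cast
      rw [pow_sub_one_eq_prod hζ]
      exact Ideal.mem_of_dvd _ (Finset.dvd_prod_of_mem α (Finset.mem_range.mpr hp.out.one_lt)) hα1P
    · rw [← intCast_mem_iff hl hlP]
      push_cast
      intro h
      apply hπP
      have e : π = -(α 1 - ((x : 𝓞 K) - 1)) := by simp only [hα, hπ, pow_one]; ring
      rw [e]
      exact P.neg_mem_iff.mpr (P.sub_mem hα1P h)


/-! ### Complex conjugation `ι = σ_{-1}`, absolute values and roots of unity -/

/-- The Galois group fixes the rational integers. [folklore] -/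
theorem gal_smul_intCast (σ : Gal(K/ℚ)) (n : ℤ) : σ • (n : 𝓞 K) = n :=
  map_intCast (MulSemiringAction.toRingHom _ (𝓞 K) σ) n

/-- `σ_a ζ = ζ^a`. [cite: Schoof2009, Ch. 9 (p. 58)] -/
theorem gal_smul_toInteger (a : (ZMod p)ˣ) : gal p K a • hζ.toInteger = hζ.toInteger ^ (a : ZMod p).val :=
  gal_smul_of_pow_eq a hζ.toInteger_isPrimitiveRoot.pow_eq_one

/-- The Galois action on `𝓞 K` is the restriction of the one on `K`. [folklore] -/
theorem coe_gal_smul (σ : Gal(K/ℚ)) (y : 𝓞 K) : ((σ • y : 𝓞 K) : K) = σ (y : K) := rfl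

include hζ in
/-- `σ_{-1}` followed by a complex embedding is the complex conjugate embedding. [folklore] -/
theorem embedding_comp_gal_neg_one (φ : K →+* ℂ) (y : K) :
    φ (gal p K (-1) y) = starRingEnd ℂ (φ y) := by
  -- both sides are ring homomorphisms `K → ℂ` agreeing on `ζ`
  let f : K →ₐ[ℚ] ℂ := (φ.comp (gal p K (-1) : K ≃ₐ[ℚ] K).toAlgHom.toRingHom).toRatAlgHom
  let g : K →ₐ[ℚ] ℂ := ((starRingEnd ℂ).comp φ).toRatAlgHom
  suffices h : f = g by
    have := congrArg (fun h : K →ₐ[ℚ] ℂ => h y) h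
    simpa [f, g] using this
  apply (hζ.powerBasis ℚ).algHom_ext
  simp only [f, g, IsPrimitiveRoot.powerBasis_gen, RingHom.toRatAlgHom, RingHom.coe_comp,
    Function.comp_apply, AlgHom.coe_mk]
  show φ ((gal p K (-1)) ζ) = starRingEnd ℂ (φ ζ)
  have h1 : (gal p K (-1)) ζ = ζ ^ ((-1 : (ZMod p)ˣ) : ZMod p).val := by
    have := gal_smul_toInteger hζ (K := K) (-1)
    have := congrArg ((↑) : 𝓞 K → K) this
    rw [coe_gal_smul] at this
    simpa using this
  rw [h1, map_pow]
  have hφζ : φ ζ ^ p = 1 := by rw [← map_pow, hζ.pow_eq_one, map_one]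
  have hnorm : ‖φ ζ‖ = 1 := Complex.norm_eq_one_of_pow_eq_one hφζ hp.out.ne_zero
  rw [Units.val_neg, Units.val_one, ZMod.neg_val, if_neg one_ne_zero, ZMod.val_one]
  -- `(φ ζ)^(p-1) = conj (φ ζ)` as `|φ ζ| = 1`
  have h2 : φ ζ ^ (p - 1) * φ ζ = starRingEnd ℂ (φ ζ) * φ ζ := by
    rw [← pow_succ, Nat.sub_add_cancel hp.out.one_lt.le, hφζ, Complex.conj_mul', hnorm]
    norm_num
  have hφ0 : φ ζ ≠ 0 := fun h => by rw [h, norm_zero] at hnorm; exact zero_ne_one hnorm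
  exact mul_right_cancel₀ hφ0 h2

include hζ in
/-- `|φ(ι y)| = |φ(y)|` for every complex embedding `φ`. [folklore] -/
theorem norm_embedding_gal_neg_one (φ : K →+* ℂ) (y : 𝓞 K) :
    ‖φ ((gal p K (-1) • y : 𝓞 K) : K)‖ = ‖φ (y : K)‖ := by
  rw [coe_gal_smul, embedding_comp_gal_neg_one hζ, RCLike.norm_conj]

/-- a unit all of whose conjugates have absolute value `1` is a `2p`-th root of unity. [folklore] -/
theorem pow_two_mul_p_eq_one_of_norm_eq_one (hp2 : p ≠ 2) (ρ : (𝓞 K)ˣ)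
    (h : ∀ φ : K →+* ℂ, ‖φ ((ρ : 𝓞 K) : K)‖ = 1) : ρ ^ (2 * p) = 1 := by
  have hmem : ρ ∈ NumberField.Units.torsion K := by
    rw [NumberField.Units.mem_torsion]
    intro w
    rw [← NumberField.InfinitePlace.mk_embedding w, NumberField.InfinitePlace.apply]
    exact h _
  rw [← NumberField.Units.rootsOfUnity_eq_torsion, mem_rootsOfUnity] at hmem
  have hodd : ¬ Even p := fun he => hp2 ((Nat.Prime.even_iff hp.out).mp he)
  have htor : NumberField.Units.torsionOrder K = 2 * p := by
    rw [IsCyclotomicExtension.Rat.torsionOrder_eq (n := p) (K := K), if_neg hodd]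
  rw [← htor]
  exact hmem

omit [NumberField K] hK in
/-- a `2p`-th root of unity is a `q`-th power for `q` prime to `2p`. [folklore] -/
theorem exists_eq_pow_of_pow_eq_one {ρ : (𝓞 K)ˣ} (hρ : ρ ^ (2 * p) = 1) {q : ℕ}
    (hq : q.Coprime (2 * p)) : ∃ ρ₁ : (𝓞 K)ˣ, ρ = ρ₁ ^ q := by
  have h2p : 1 < 2 * p := by have := hp.out.two_le; omega
  obtain ⟨k, -, hk⟩ := Nat.exists_mul_mod_eq_one_of_coprime hq h2p
  refine ⟨ρ ^ k, ?_⟩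
  rw [← pow_mul, mul_comm, ← Nat.div_add_mod (q * k) (2 * p), hk, pow_add, pow_mul, hρ, one_pow,
    one_mul, pow_one]

include hζ in
/-- if `a ≠ 0` and `ι a = a ρ` for a unit `ρ`, then `ρ` is a `2p`-th root of unity. [folklore] -/
theorem pow_eq_one_of_smul_eq_mul (hp2 : p ≠ 2) {a : 𝓞 K} (ha : a ≠ 0) {ρ : (𝓞 K)ˣ}
    (h : gal p K (-1) • a = a * ρ) : ρ ^ (2 * p) = 1 := by
  apply pow_two_mul_p_eq_one_of_norm_eq_one hp2
  intro φ
  have h1 := norm_embedding_gal_neg_one hζ φ a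
  rw [h] at h1
  push_cast at h1
  rw [map_mul, norm_mul] at h1
  have ha' : ‖φ (a : K)‖ ≠ 0 := by
    rw [norm_ne_zero_iff, _root_.map_ne_zero]
    exact_mod_cast ha
  field_simp at h1
  linarith [h1]


/-! ### `I^θ` for principal ideals and conjugates -/

/-- `σ_a σ_b = σ_b σ_a` (`G` is abelian). [folklore] -/
theorem gal_comm (a b : (ZMod p)ˣ) : gal p K a * gal p K b = gal p K b * gal p K a := by
  rw [← gal_mul, ← gal_mul, mul_comm]

/-- `σ_a (I^θ) = (σ_a I)^θ` (`G` is abelian). [folklore] -/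
theorem smul_idealPow (a : (ZMod p)ˣ) (n : (ZMod p)ˣ → ℕ) (I : Ideal (𝓞 K)) :
    gal p K a • idealPow n I = idealPow n (gal p K a • I) := by
  unfold idealPow
  rw [Finset.smul_prod']
  apply Finset.prod_congr rfl
  intro c _
  rw [smul_pow', smul_smul, smul_smul, ← gal_inv (p := p) (K := K), gal_comm a]

/-- `(I^k)^θ = (I^θ)^k`. [folklore] -/
theorem idealPow_pow (n : (ZMod p)ˣ → ℕ) (I : Ideal (𝓞 K)) (k : ℕ) :
    idealPow n (I ^ k) = idealPow n I ^ k := by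
  induction k with
  | zero => rw [pow_zero, pow_zero, Ideal.one_eq_top, idealPow_top]
  | succ k ih => rw [pow_succ, idealPow_mul, ih, pow_succ]

/-- `(y)^θ = (∏_c (σ_c⁻¹ y)^{n_c})` for a principal ideal. [folklore] -/
theorem idealPow_span_singleton (n : (ZMod p)ˣ → ℕ) (y : 𝓞 K) :
    idealPow n (Ideal.span {y}) = Ideal.span {∏ c : (ZMod p)ˣ, ((gal p K c)⁻¹ • y) ^ n c} := by
  unfold idealPow
  rw [← Ideal.prod_span_singleton]
  apply Finset.prod_congr rfl
  intro c _
  rw [span_smul_singleton, Ideal.span_singleton_pow]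

/-- `∏_c (σ_c⁻¹ y)^{n_c} ≠ 0` for `y ≠ 0`. [folklore] -/
theorem prod_ne_zero_of_smul {n : (ZMod p)ˣ → ℕ} {y : 𝓞 K} (hy : y ≠ 0) :
    ∏ c : (ZMod p)ˣ, ((gal p K c)⁻¹ • y) ^ n c ≠ 0 := by
  apply Finset.prod_ne_zero_iff.mpr
  intro c _
  apply pow_ne_zero
  intro h
  apply hy
  have := congrArg (fun t => gal p K c • t) h
  simpa using this

/-- the units `(ℤ/pℤ)ˣ` versus `Ico 1 p`. [folklore] -/
theorem prod_units_eq_prod_Ico {M : Type*} [CommMonoid M] (F : ℕ → M) :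
    ∏ c : (ZMod p)ˣ, F ((c : ZMod p).val) = ∏ i ∈ Ico 1 p, F i := by
  classical
  have himage : (Finset.univ : Finset (ZMod p)ˣ).image (fun c : (ZMod p)ˣ => (c : ZMod p).val) =
      Ico 1 p := by
    ext i
    simp only [Finset.mem_image, Finset.mem_univ, true_and, Finset.mem_Ico]
    constructor
    · rintro ⟨c, rfl⟩
      exact ⟨val_pos c, ZMod.val_lt _⟩
    · rintro ⟨h1, h2⟩
      have hi : (i : ZMod p) ≠ 0 := by
        rw [Ne, ZMod.natCast_eq_zero_iff]
        intro h; have := Nat.le_of_dvd (by omega) h; omega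
      refine ⟨Units.mk0 _ hi, ?_⟩
      rw [Units.val_mk0, ZMod.val_natCast, Nat.mod_eq_of_lt h2]
  rw [← himage, Finset.prod_image]
  intro c _ d _ h
  exact Units.ext (ZMod.val_injective p h)

omit [NumberField K] hK in
/-- `ζ^a = ζ^b` for `a ≡ b (mod p)`. [folklore] -/
theorem toInteger_pow_eq_pow {a b : ℕ} (h : a % p = b % p) : hζ.toInteger ^ a = hζ.toInteger ^ b := by
  rw [← Nat.mod_add_div a p, ← Nat.mod_add_div b p, pow_add, pow_add, pow_mul, pow_mul,
    hζ.toInteger_isPrimitiveRoot.pow_eq_one, one_pow, one_pow, h]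

/-- The representative of `-c` is `p - c`. [folklore] -/
theorem val_neg_units (c : (ZMod p)ˣ) : ((-c : (ZMod p)ˣ) : ZMod p).val = p - (c : ZMod p).val := by
  rw [Units.val_neg, ZMod.neg_val, if_neg c.ne_zero]

/-! ### `(x - ζ_p)^θ` for `θ ∈ ℤ[G]` -/

omit hK in
include hζ in
/-- `x - ζ^c ≠ 0` for a unit `c` modulo the odd prime `p`: a primitive `p`-th root of unity is not a
rational integer. [folklore] -/
theorem intCast_sub_zeta_pow_ne_zero (hp2 : p ≠ 2) (x : ℤ) (c : (ZMod p)ˣ) :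
    (x : K) - ζ ^ (c : ZMod p).val ≠ 0 := by
  intro h
  have hprim : IsPrimitiveRoot (ζ ^ (c : ZMod p).val) p :=
    hζ.pow_of_coprime _ (ZMod.val_coe_unit_coprime c)
  have hx : (x : K) = ζ ^ (c : ZMod p).val := sub_eq_zero.mp h
  have hxp : x ^ p = 1 := by
    have : ((x : K)) ^ p = 1 := by rw [hx, hprim.pow_eq_one]
    exact_mod_cast this
  have habs : |x| = 1 := by
    have h1 : |x| ^ p = 1 := by rw [← abs_pow, hxp, abs_one]
    exact (pow_eq_one_iff_of_nonneg (abs_nonneg x) hp.out.ne_zero).mp h1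
  rcases abs_eq (zero_le_one' ℤ) |>.mp habs with h1 | h1
  · rw [h1, Int.cast_one] at hx
    exact hprim.ne_one hp.out.one_lt hx.symm
  · rw [h1, (hp.out.odd_of_ne_two hp2).neg_one_pow] at hxp
    norm_num at hxp

/-- **`(x - ζ_p)^θ`**: for `θ = ∑_c n_c σ_c ∈ ℤ[G]` (`n_c = θ.coeff c`, `σ_c ζ_p = ζ_p^c`) and an integer `x`,
`zpowGal ζ x θ = ∏_c (x - ζ_p^c)^{n_c} = ∏_σ σ(x - ζ_p)^{n_σ} ∈ K`. [cite: Schoof2009, Ch. 11 (p. 69)] -/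
noncomputable def zpowGal (ζ : K) (x : ℤ) (θ : MonoidAlgebra ℤ (ZMod p)ˣ) : K :=
  ∏ c : (ZMod p)ˣ, ((x : K) - ζ ^ (c : ZMod p).val) ^ (θ.coeff c)

omit [NumberField K] hK in
/-- `(x - ζ)^0 = 1`. [folklore] -/
theorem zpowGal_zero (x : ℤ) : zpowGal (p := p) ζ x 0 = 1 := by
  simp [zpowGal]

include hζ in
omit hK in
/-- `(x - ζ)^θ ≠ 0`. [folklore] -/
theorem zpowGal_ne_zero (hp2 : p ≠ 2) (x : ℤ) (θ : MonoidAlgebra ℤ (ZMod p)ˣ) : zpowGal ζ x θ ≠ 0 :=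
  prod_ne_zero_iff.mpr fun c _ => zpow_ne_zero _ (intCast_sub_zeta_pow_ne_zero hζ hp2 x c)

include hζ in
omit hK in
/-- `(x - ζ)^{θ + θ'} = (x - ζ)^θ (x - ζ)^{θ'}`. [cite: Schoof2009, Lemma 11.1 ("a well defined homomorphism")] -/
theorem zpowGal_add (hp2 : p ≠ 2) (x : ℤ) (θ θ' : MonoidAlgebra ℤ (ZMod p)ˣ) :
    zpowGal ζ x (θ + θ') = zpowGal ζ x θ * zpowGal ζ x θ' := by
  unfold zpowGal
  rw [← prod_mul_distrib]
  refine prod_congr rfl fun c _ => ?_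
  rw [MonoidAlgebra.coeff_add, Finsupp.add_apply,
    zpow_add₀ (intCast_sub_zeta_pow_ne_zero hζ hp2 x c)]

omit [NumberField K] hK in
/-- `(x - ζ)^{-θ} = ((x - ζ)^θ)⁻¹`. [folklore] -/
theorem zpowGal_neg (x : ℤ) (θ : MonoidAlgebra ℤ (ZMod p)ˣ) :
    zpowGal ζ x (-θ) = (zpowGal ζ x θ)⁻¹ := by
  unfold zpowGal
  rw [← prod_inv_distrib]
  refine prod_congr rfl fun c _ => ?_
  rw [MonoidAlgebra.coeff_neg, Finsupp.neg_apply, zpow_neg]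

omit hK in
include hζ in
/-- `(x - ζ)^{θ - θ'} = (x - ζ)^θ / (x - ζ)^{θ'}`. [folklore] -/
theorem zpowGal_sub (hp2 : p ≠ 2) (x : ℤ) (θ θ' : MonoidAlgebra ℤ (ZMod p)ˣ) :
    zpowGal ζ x (θ - θ') = zpowGal ζ x θ / zpowGal ζ x θ' := by
  rw [sub_eq_add_neg, zpowGal_add hζ hp2, zpowGal_neg, div_eq_mul_inv]

omit hK in
include hζ in
/-- `(x - ζ)^{n θ} = ((x - ζ)^θ)^n` for `n ∈ ℤ`. [folklore] -/
theorem zpowGal_zsmul (hp2 : p ≠ 2) (x : ℤ) (n : ℤ) (θ : MonoidAlgebra ℤ (ZMod p)ˣ) :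
    zpowGal ζ x (n • θ) = zpowGal ζ x θ ^ n := by
  induction n using Int.induction_on with
  | zero => rw [zero_smul, zpowGal_zero, zpow_zero]
  | succ i ih =>
    rw [add_smul, one_smul, zpowGal_add hζ hp2, ih, zpow_add_one₀ (zpowGal_ne_zero hζ hp2 x θ)]
  | pred i ih =>
    rw [sub_smul, one_smul, zpowGal_sub hζ hp2, ih, zpow_sub_one₀ (zpowGal_ne_zero hζ hp2 x θ),
      div_eq_mul_inv]

include hζ in
/-- `σ_u ζ = ζ^u` in `K`. [cite: Schoof2009, Ch. 9 (p. 58)] -/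
theorem gal_apply_zeta (u : (ZMod p)ˣ) : (gal p K u) ζ = ζ ^ (u : ZMod p).val := by
  have h := congrArg ((↑) : 𝓞 K → K) (gal_smul_toInteger hζ (K := K) u)
  rw [coe_gal_smul] at h
  simpa using h

include hζ in
/-- `σ_u (ζ^c) = ζ^{uc}`. [folklore] -/
theorem gal_apply_zeta_pow (u c : (ZMod p)ˣ) :
    (gal p K u) (ζ ^ (c : ZMod p).val) = ζ ^ ((u * c : (ZMod p)ˣ) : ZMod p).val := by
  rw [map_pow, gal_apply_zeta hζ, ← pow_mul, val_mul]
  conv_lhs => rw [← Nat.mod_add_div ((u : ZMod p).val * (c : ZMod p).val) p, pow_add, pow_mul,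
    hζ.pow_eq_one, one_pow, mul_one]

include hζ in
/-- **`G`-equivariance of `θ ↦ (x - ζ)^θ`**: `(x - ζ)^{σ_u θ} = σ_u((x - ζ)^θ)`.
[cite: Schoof2009, Ch. 11 (p. 69)] -/
theorem zpowGal_single_mul (x : ℤ) (u : (ZMod p)ˣ) (θ : MonoidAlgebra ℤ (ZMod p)ˣ) :
    zpowGal ζ x (single u (1 : ℤ) * θ) = gal p K u (zpowGal ζ x θ) := by
  unfold zpowGal
  rw [map_prod]
  refine (Fintype.prod_equiv (Equiv.mulLeft u) _ _ fun c => ?_).symm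
  rw [Equiv.coe_mulLeft, coeff_single_mul, inv_mul_cancel_left, map_zpow₀, map_sub, map_intCast,
    gal_apply_zeta_pow hζ]

include hζ in
/-- `(x - ζ)^{ι θ} = ι((x - ζ)^θ)` with `ι = σ_{-1}` complex conjugation. [cite: Schoof2009, Ch. 11 (p. 69)] -/
theorem zpowGal_iota_mul (x : ℤ) (θ : MonoidAlgebra ℤ (ZMod p)ˣ) :
    zpowGal ζ x (iota p * θ) = gal p K (-1) (zpowGal ζ x θ) :=
  zpowGal_single_mul hζ x (-1) θ

include hζ in
/-- **`(x - ζ)^{θ_b}` is the algebraic integer `∏_c (σ_c⁻¹(x - ζ))^{⌊bc/p⌋}`** (`θ_b = ∑_c ⌊bc/p⌋ σ_c⁻¹`).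
[cite: Schoof2009, Proposition 10.1 (proof)] -/
theorem zpowGal_theta (x : ℤ) (b : ℕ) :
    zpowGal ζ x (theta p b) =
      ((∏ c : (ZMod p)ˣ, ((gal p K c)⁻¹ • ((x : 𝓞 K) - hζ.toInteger)) ^ quot p b c : 𝓞 K) : K) := by
  unfold zpowGal
  push_cast
  refine Fintype.prod_equiv (Equiv.inv (ZMod p)ˣ) _ _ fun c => ?_
  rw [Equiv.inv_apply, coeff_theta, zpow_natCast, gal_inv, inv_inv, AlgEquiv.smul_def, map_sub]
  congr 2
  · exact (map_intCast (gal p K c) x).symm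
  · exact (gal_apply_zeta hζ c).symm

/-! ### Proposition 10.1: `(x - ζ_p)^{(1-ι)θ_b}` is a `q`-th power -/

include hζ in
/-- `ι 𝔭 = 𝔭` for `𝔭 = (ζ - 1)` (`ι(ζ - 1) = ζ⁻¹ - 1 ∼ ζ - 1`). [cite: Schoof2009, Exercise 7.2] -/
theorem iota_smul_span_zeta_sub_one (hp2 : p ≠ 2) :
    gal p K (-1) • Ideal.span {hζ.toInteger - 1} = Ideal.span {hζ.toInteger - 1} := by
  have : 3 ≤ p := by
    have := hp.out.two_le
    rcases Nat.eq_or_lt_of_le this with h | h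
    · exact absurd h.symm hp2
    · omega
  rw [span_smul_singleton, Ideal.span_singleton_eq_span_singleton, smul_sub,
    gal_smul_toInteger hζ, smul_one, Units.val_neg, Units.val_one, ZMod.neg_val,
    if_neg one_ne_zero, ZMod.val_one]
  exact associated_pow_sub_one hζ (j := p - 1) (fun h => by
    have := Nat.le_of_dvd (by omega) h; omega)

include hζ in
/-- **[Schoof2009, Proposition 10.1] for the generators `θ_b`** of the Stickelberger ideal: for a
non-zero solution of Catalan's equation in the form of Cassels' Corollary 6.5 (`∑_{i<p} x^i = p v^q`,
`p ∣ x - 1`, `x ≠ 1`; `p, q` distinct odd primes), `(x - ζ_p)^{(1-ι)θ_b} = α^q` for some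
`α ∈ K^*`, for every `b`. (Ideal factorisation `(x - ζ_p) = 𝔭𝔟^q`, Stickelberger's theorem for `𝔟^{θ_b}`,
and Kronecker: `ε^{1-ι}` and `π^{1-ι} ∼ -ζ_p` are `2p`-th roots of unity, hence `q`-th powers.)
[cite: Schoof2009, Proposition 10.1] -/
theorem exists_zpowGal_theta_eq_pow_of_sum_eq (hp2 : p ≠ 2) {x v : ℤ} {q : ℕ} (hq : q.Prime)
    (hqp : q ≠ p) (hq2 : q ≠ 2) (hx1 : x ≠ 1) (hS : ∑ i ∈ range p, x ^ i = p * v ^ q)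
    (hpx : (p : ℤ) ∣ x - 1) (b : ℕ) :
    ∃ α : K, α ≠ 0 ∧ zpowGal ζ x ((1 - iota p) * theta p b) = α ^ q := by
  classical
  have hp3 : 3 ≤ p := by
    have := hp.out.two_le
    rcases Nat.eq_or_lt_of_le this with h | h
    · exact absurd h.symm hp2
    · omega
  obtain ⟨𝔟, hfac, h𝔟0, hdeg⟩ := span_sub_zeta_eq hζ hp3 hq.ne_zero hx1 hS hpx
  set ζi : 𝓞 K := hζ.toInteger with hζi
  set π : 𝓞 K := ζi - 1 with hπ
  set ι : Gal(K/ℚ) := gal p K (-1) with hι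
  set m : (ZMod p)ˣ → ℕ := quot p b with hm
  -- Stickelberger: `𝔟^{θ_b} = (γ)`
  obtain ⟨γ, hγ⟩ := (isPrincipal_idealPow_quot_of_factors (K := K) hp2 h𝔟0 hdeg b).principal
  rw [Ideal.submodule_span_eq] at hγ
  change idealPow m 𝔟 = Ideal.span {γ} at hγ
  -- generators `A = (x - ζ)^{θ_b}`, `Pi1 = π^{θ_b}`
  set A : 𝓞 K := ∏ c : (ZMod p)ˣ, ((gal p K c)⁻¹ • ((x : 𝓞 K) - ζi)) ^ m c with hAdef
  set Pi1 : 𝓞 K := ∏ c : (ZMod p)ˣ, ((gal p K c)⁻¹ • π) ^ m c with hPi1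
  have hA : idealPow m (Ideal.span {(x : 𝓞 K) - ζi}) = Ideal.span {A} := idealPow_span_singleton m _
  have hPi : idealPow m (Ideal.span {π}) = Ideal.span {Pi1} := idealPow_span_singleton m π
  have hAeq : Ideal.span {A} = Ideal.span {Pi1 * γ ^ q} := by
    rw [← hA, hfac, idealPow_mul, idealPow_pow, hPi, hγ, Ideal.span_singleton_pow,
      Ideal.span_singleton_mul_span_singleton]
  obtain ⟨u, hu⟩ := Ideal.span_singleton_eq_span_singleton.mp hAeq
  -- nonvanishing
  have hπ0 : π ≠ 0 := (prime_zeta_sub_one hζ).ne_zero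
  have hPi0 : Pi1 ≠ 0 := prod_ne_zero_of_smul hπ0
  have hγ0 : γ ≠ 0 := by
    intro h0
    apply idealPow_ne_bot m h𝔟0
    rw [hγ, h0, Ideal.span_singleton_eq_bot]
  have hA0 : A ≠ 0 := by
    intro h0
    rw [h0, zero_mul] at hu
    exact mul_ne_zero hPi0 (pow_ne_zero _ hγ0) hu.symm
  -- `ι Pi1 = Pi1 ρ` with `ρ` a `2p`-th root of unity
  have hiotaPi : Ideal.span {ι • Pi1} = Ideal.span {Pi1} := by
    rw [← span_smul_singleton, ← hPi, hι, smul_idealPow, iota_smul_span_zeta_sub_one hζ hp2]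
  obtain ⟨ρ, hρ⟩ := Ideal.span_singleton_eq_span_singleton.mp hiotaPi.symm
  have hρ2p : ρ ^ (2 * p) = 1 := pow_eq_one_of_smul_eq_mul hζ hp2 hPi0 hρ.symm
  -- `ι u = u η` with `η` a `2p`-th root of unity
  set uι : (𝓞 K)ˣ := Units.map (MulSemiringAction.toRingHom Gal(K/ℚ) (𝓞 K) ι).toMonoidHom u
    with huι
  have huι' : (uι : 𝓞 K) = ι • (u : 𝓞 K) := rfl
  set η : (𝓞 K)ˣ := u⁻¹ * uι with hηdef
  have hη : ι • (u : 𝓞 K) = u * η := by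
    rw [hηdef, Units.val_mul, ← mul_assoc, Units.mul_inv, one_mul, huι']
  have hη2p : η ^ (2 * p) = 1 := pow_eq_one_of_smul_eq_mul hζ hp2 u.ne_zero hη
  -- apply `ι` to `A u = Pi1 γ^q`
  have h1 : (ι • A) * (u * η) = Pi1 * ρ * (ι • γ) ^ q := by
    have := congrArg (fun t : 𝓞 K => ι • t) hu
    simp only [smul_mul', smul_pow'] at this
    rw [hη, ← hρ] at this
    exact this
  -- the unit `ω = η ρ⁻¹` is a `q`-th power
  set ω : (𝓞 K)ˣ := η * ρ⁻¹ with hωdef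
  have hω2p : ω ^ (2 * p) = 1 := by
    rw [hωdef, mul_pow, inv_pow, hρ2p, hη2p, inv_one, mul_one]
  have hqcop : q.Coprime (2 * p) := by
    rw [Nat.coprime_mul_iff_right]
    exact ⟨(Nat.coprime_primes hq Nat.prime_two).mpr hq2, (Nat.coprime_primes hq hp.out).mpr hqp⟩
  obtain ⟨ω₁, hω₁⟩ := exists_eq_pow_of_pow_eq_one hω2p hqcop
  -- the key identity `A ρ (ιγ)^q = (ιA) η γ^q`
  have hιγ0 : ι • γ ≠ 0 := by
    intro h0
    apply hγ0
    have hιι : ι * ι = 1 := by rw [hι, ← gal_mul, neg_mul_neg, one_mul, gal_one]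
    have := congrArg (fun t : 𝓞 K => ι • t) h0
    simp only [smul_smul, hιι, one_smul, smul_zero] at this
    exact this
  have hkey : A * (ρ * (ι • γ) ^ q) = (ι • A) * (η * γ ^ q) := by
    have h2 : (A * (ρ * (ι • γ) ^ q) - (ι • A) * (η * γ ^ q)) * (u * η) = 0 := by
      linear_combination (↑ρ * (ι • γ) ^ q * ↑η) * hu - (↑η * γ ^ q) * h1
    rcases mul_eq_zero.mp h2 with h3 | h3
    · exact sub_eq_zero.mp h3
    · exact absurd h3 (mul_ne_zero u.ne_zero η.ne_zero)
  -- conclusion in `K`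
  refine ⟨((ω₁ : 𝓞 K) : K) * (γ : K) / ((ι • γ : 𝓞 K) : K), ?_, ?_⟩
  · refine div_ne_zero (mul_ne_zero ?_ ?_) ?_
    · exact_mod_cast ω₁.ne_zero
    · exact_mod_cast hγ0
    · exact_mod_cast hιγ0
  · rw [sub_mul, one_mul, zpowGal_sub hζ hp2, zpowGal_iota_mul hζ, zpowGal_theta hζ, ← hm, ← hζi,
      ← hAdef, ← coe_gal_smul, ← hι]
    have hA0' : ((A : 𝓞 K) : K) ≠ 0 := by exact_mod_cast hA0
    have hιA0 : ((ι • A : 𝓞 K) : K) ≠ 0 := by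
      intro h0
      apply hA0
      have hιι : ι * ι = 1 := by rw [hι, ← gal_mul, neg_mul_neg, one_mul, gal_one]
      have h0' : ι • A = 0 := by exact_mod_cast h0
      have := congrArg (fun t : 𝓞 K => ι • t) h0'
      simp only [smul_smul, hιι, one_smul, smul_zero] at this
      exact this
    have hιγ0' : ((ι • γ : 𝓞 K) : K) ≠ 0 := by exact_mod_cast hιγ0
    have hρ0 : ((ρ : 𝓞 K) : K) ≠ 0 := by exact_mod_cast ρ.ne_zero
    have hkey' : ((A : 𝓞 K) : K) * ((ρ : 𝓞 K) * ((ι • γ : 𝓞 K) : K) ^ q) =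
        ((ι • A : 𝓞 K) : K) * ((η : 𝓞 K) * (γ : K) ^ q) := by exact_mod_cast hkey
    have hωK : ((η : 𝓞 K) : K) = (ω₁ : 𝓞 K) ^ q * (ρ : 𝓞 K) := by
      have hηω : η = ω * ρ := by rw [hωdef, inv_mul_cancel_right]
      rw [hηω, Units.val_mul, hω₁, Units.val_pow_eq_pow_val]
      push_cast
      ring
    rw [div_pow, mul_pow, eq_div_iff (pow_ne_zero _ hιγ0'), div_mul_eq_mul_div, div_eq_iff hιA0]
    rw [hωK] at hkey'
    apply mul_left_cancel₀ hρ0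
    linear_combination hkey'

include hζ in
/-- **[Schoof2009, Proposition 10.1], for the generators `θ_b`**, from a non-zero solution of Catalan's
equation `x ^ p - y ^ q = 1` (`p, q` odd primes): `(x - ζ_p)^{(1-ι)θ_b} = α^q`, `α ∈ K^*`.
[cite: Schoof2009, Proposition 10.1] -/
theorem exists_zpowGal_theta_eq_pow {q : ℕ} (hq : q.Prime) (hpo : Odd p) (hqo : Odd q) {x y : ℤ}
    (hx : x ≠ 0) (hy : y ≠ 0) (h : x ^ p - y ^ q = 1) (b : ℕ) :
    ∃ α : K, α ≠ 0 ∧ zpowGal ζ x ((1 - iota p) * theta p b) = α ^ q := by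
  have hp2 : p ≠ 2 := fun h2 => by rw [h2] at hpo; exact (Nat.not_odd_iff_even.mpr even_two) hpo
  have hq2 : q ≠ 2 := fun h2 => by rw [h2] at hqo; exact (Nat.not_odd_iff_even.mpr even_two) hqo
  have hqp : q ≠ p := by
    rintro rfl
    exact pow_sub_pow_ne_one hqo (by have := hq.two_le; omega) hx hy h
  obtain ⟨a, v, h1, hS, -, -, -⟩ := cassels_padic hp.out hq hpo hqo hx hy h
  have hx1 : x ≠ 1 := by
    rintro rfl
    rw [one_pow, sub_eq_iff_eq_add] at h
    have : y ^ q = 0 := by linarith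
    exact hy (pow_eq_zero_iff hq.ne_zero |>.mp this)
  have hpx : (p : ℤ) ∣ x - 1 := by
    refine ⟨(p : ℤ) ^ (q - 2) * a ^ q, ?_⟩
    rw [h1, show q - 1 = (q - 2) + 1 by have := hq.two_le; omega, pow_succ]
    ring
  exact exists_zpowGal_theta_eq_pow_of_sum_eq hζ hp2 hq hqp hq2 hx1 hS hpx b

include hζ in
/-- **[Schoof2009, Proposition 10.1]**: `(x - ζ_p)^θ` is a `q`-th power in `K^*` for every `θ` in the
`ℤ`-span of the elements `(1 - ι)θ_b` — which contains the ideal `I = (1 - ι)𝒮` of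
[Schoof2009, Theorem 9.3 (ii)], in particular the `e_i = (1-ι)(θ_{i+1} - θ_i)` and all `∑ λ_i e_i`.
[cite: Schoof2009, Proposition 10.1] -/
theorem exists_zpowGal_eq_pow {q : ℕ} (hq : q.Prime) (hpo : Odd p) (hqo : Odd q) {x y : ℤ}
    (hx : x ≠ 0) (hy : y ≠ 0) (h : x ^ p - y ^ q = 1) {θ : MonoidAlgebra ℤ (ZMod p)ˣ}
    (hθ : θ ∈ Submodule.span ℤ (Set.range fun b : ℕ => (1 - iota p) * theta p b)) :
    ∃ α : K, α ≠ 0 ∧ zpowGal ζ x θ = α ^ q := by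
  have hp2 : p ≠ 2 := fun h2 => by rw [h2] at hpo; exact (Nat.not_odd_iff_even.mpr even_two) hpo
  induction hθ using Submodule.span_induction with
  | mem θ hθ =>
    obtain ⟨b, rfl⟩ := hθ
    exact exists_zpowGal_theta_eq_pow hζ hq hpo hqo hx hy h b
  | zero => exact ⟨1, one_ne_zero, by rw [zpowGal_zero, one_pow]⟩
  | add θ θ' _ _ ih ih' =>
    obtain ⟨α, hα0, hα⟩ := ih
    obtain ⟨α', hα0', hα'⟩ := ih'
    exact ⟨α * α', mul_ne_zero hα0 hα0', by rw [zpowGal_add hζ hp2, hα, hα', mul_pow]⟩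
  | smul n θ _ ih =>
    obtain ⟨α, hα0, hα⟩ := ih
    exact ⟨α ^ n, zpow_ne_zero _ hα0, by rw [zpowGal_zsmul hζ hp2, hα, ← zpow_natCast, ← zpow_mul,
      mul_comm, zpow_mul, zpow_natCast]⟩

/-- The elements `e_i = (1 - ι)(θ_{i+1} - θ_i)` lie in the `ℤ`-span of the `(1 - ι)θ_b`, so
[Schoof2009, Proposition 10.1] applies to every `∑ λ_i e_i`. [cite: Schoof2009, Theorem 9.3 (ii)] -/
theorem e_mem_span_one_sub_iota_mul_theta (i : ℕ) :
    e p i ∈ Submodule.span ℤ (Set.range fun b : ℕ => (1 - iota p) * theta p b) := by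
  rw [e, f, mul_sub]
  exact Submodule.sub_mem _ (Submodule.subset_span ⟨i + 1, rfl⟩) (Submodule.subset_span ⟨i, rfl⟩)

end Cyclotomic

end Catalan.Minus

end Literature.NumberTheory.DiophantineGeometry
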